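import Summits.Ventures.HodgeRepro.RectQuad6

/-!
# A fifth mechanism: the rectangle `{1, w₁c, w₂c, w₁w₂}` of two independent elements of order `3`

Blind re-derivation cell `pub-hodge-repro`, seat `p1` (gen 10).  The gen-10 abelian census found an instance on
`C₃ × C₁₂` with `c = (0, 6)` — a pair `(G, c)` with a UNIQUE involution and non-cyclic odd part, uncovered by all
four mechanisms known so far (cyclic coset, Klein coset, cyclic recipe, involution rectangle): the rectangle
`Δ = {0, u, v, u + v}` with `u = (0, 2)`, `v = (1, 10)` — both of order `6` with `3u = 3v = c`, i.e. `u = w₁c`,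
`v = w₂c` for the independent elements `w₁ = (0, 8)`, `w₂ = (1, 4)` of order `3`.  A Fourier argument predicts
exactly this shape for any instance on `C₄ × C₃ × C₃`: an odd character `χ = (ε, ρ)` has `χ(g) = −1` only if the
`C₄`-component of `g` is `2` and `ρ` kills the odd component, so every `4`-set carrying an instance has
`C₄`-components `(0, 2, 2, 0)` and odd components `(0, y₁, y₂, y₁ + y₂)`.

The local group is `W = ⟨c, w₁, w₂⟩ ≅ ℤ/2 × ℤ/3 × ℤ/3` (`c = (1,0,0)`, `w₁ = (0,1,0)`, `w₂ = (0,0,1)`, so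
`u = (1,1,0)`, `v = (1,0,1)`, `uv = (0,1,1)`), and the census witness splits into two local solutions with
DISJOINT bad sets: type A `{(s, a, b) : [s = 0] ⟺ [a = 1]}` (the type induced from `W/⟨w₂⟩`; a conjugate
pair only through `v`) and type B `{(s, a, b) : [s = 0] ⟺ [b = 2]}` (induced from `W/⟨w₁⟩`; a conjugate pair
only through `u`); so two cosets of `W` suffice, i.e. `|G| ≥ 36`.  All of this is `decide` on the 18-element `W` through the generic
theorem `exists_quad_of_pattern`:

* `exists_rectQuad33`: for every finite `(G, c)` and every injective hom `ψ : ℤ/2 × ℤ/3 × ℤ/3 →* G` with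
  `ψ (1,0,0) = c`, if `36 ≤ |G|` then some CM type `Φ` has `Φ, Φ·ψ(1,1,0), Φ·ψ(1,0,1), Φ·ψ(0,1,1)` `SumTwo`
  without a conjugate pair;
* `exists_rectQuad33_of_elems`: the same for commuting elements `w₁, w₂` of order `3` with `w₂ ∉ ⟨w₁⟩`
  (twists `1, w₁c, w₂c, w₁w₂`), the injectivity being proved by cubing (`(cˢ w₁ᵃ w₂ᵇ)³ = cˢ`).

Instances: `(C₃ × C₁₂, (0, 6))` (order 36, the first), `(C₆ × C₆, every c)`, `(C₃ × C₃ × C₄ × C₂, …)`, and every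
abelian `(G, c)` whose odd part has `3`-rank `≥ 2`, once `|G| ≥ 36` — in particular the uncovered class «unique
involution, non-cyclic odd part» is NOT empty.
-/

set_option autoImplicit false

open Finset
open scoped Pointwise

namespace HodgeRepro.CosetQuad

variable {G : Type*} [Group G]

/-- The abstract group `ℤ/2 × ℤ/3 × ℤ/3` of the two-order-`3` rectangle mechanism. -/
abbrev P18 : Type := Multiplicative (ZMod 2) × (Multiplicative (ZMod 3) × Multiplicative (ZMod 3))

/-- The twists `1, (1,1,0), (1,0,1), (0,1,1)`, mapped to `1, w₁c, w₂c, w₁w₂`. -/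
def rectTwist33 (i : Fin 4) : P18 :=
  ![(1, 1, 1), (Multiplicative.ofAdd 1, Multiplicative.ofAdd 1, 1),
    (Multiplicative.ofAdd 1, 1, Multiplicative.ofAdd 1), (1, Multiplicative.ofAdd 1, Multiplicative.ofAdd 1)] i

/-- The element `(1, 0, 0)` of `P18`, mapped to `c`. -/
def rectConj33 : P18 := (Multiplicative.ofAdd 1, 1, 1)

/-- The two local solutions on `W = ℤ/2 × ℤ/3 × ℤ/3` as a pattern — the CM types INDUCED from the two
quotients `W/⟨w₂⟩` and `W/⟨w₁⟩`.  Label `0` (type A): `[s = 0] ⟺ [a = 1]`; label `1` (type B):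
`[s = 0] ⟺ [b = 2]`.  Type A has a conjugate pair only through `v = w₂c`, type B only through `u = w₁c`. -/
def rectPattern33 (l : Fin 2) (p : P18) : Bool :=
  if l = 0 then decide (Multiplicative.toAdd p.1 = 0) == decide (Multiplicative.toAdd p.2.1 = 1)
  else decide (Multiplicative.toAdd p.1 = 0) == decide (Multiplicative.toAdd p.2.2 = 2)

/-- **The two-order-`3` rectangle mechanism, hom form.**  For every finite `(G, c)` and every injective hom
`ψ : ℤ/2 × ℤ/3 × ℤ/3 →* G` with `ψ (1,0,0) = c`: if `36 ≤ |G|`, some CM type `Φ` has the twists by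
`ψ (1,1,0), ψ (1,0,1), ψ (0,1,1)` `SumTwo` without a conjugate pair. -/
theorem exists_rectQuad33 [Fintype G] [DecidableEq G] (ψ : P18 →* G) (hψ : Function.Injective ψ) {c : G}
    (hc : IsComplexConj c) (hψc : ψ rectConj33 = c) (hG : 36 ≤ Fintype.card G) :
    ∃ Φ : Finset G, IsCMType c Φ ∧ SumTwo (fun i => rmul Φ (ψ (rectTwist33 i))) ∧
      ∀ i j : Fin 4, rmul Φ (ψ (rectTwist33 j)) ≠ c • rmul Φ (ψ (rectTwist33 i)) := by
  have hcard : Fintype.card (Fin 2) * Fintype.card P18 ≤ Fintype.card G := by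
    rw [Fintype.card_fin, show Fintype.card P18 = 18 from rfl]
    exact hG
  exact exists_quad_of_pattern ψ hψ hc hψc rectTwist33 rectPattern33 (by decide) (by decide) (by decide)
    hcard

/-- The hom `ℤ/2 × ℤ/3 × ℤ/3 →* G`, `(s, a, b) ↦ cˢ w₁ᵃ w₂ᵇ`, for a complex conjugation `c` and commuting
`w₁, w₂` of order `3`. -/
def rectHom33 {c : G} (hc : IsComplexConj c) {w₁ w₂ : G} (h1 : orderOf w₁ = 3) (h2 : orderOf w₂ = 3)
    (h12 : w₁ * w₂ = w₂ * w₁) : P18 →* G :=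
  (zmodPowHom 2 c (conj_sq_eq_one hc)).noncommCoprod
    ((zmodPowHom 3 w₁ (by rw [← h1, pow_orderOf_eq_one])).noncommCoprod
      (zmodPowHom 3 w₂ (by rw [← h2, pow_orderOf_eq_one])) fun _ _ => Commute.pow_pow h12 _ _)
    fun _ _ => Commute.mul_right (Commute.pow_pow (hc.comm w₁) _ _) (Commute.pow_pow (hc.comm w₂) _ _)

/-- `rectHom33 (s, a, b) = cˢ w₁ᵃ w₂ᵇ`. -/
theorem rectHom33_apply {c : G} (hc : IsComplexConj c) {w₁ w₂ : G} (h1 : orderOf w₁ = 3)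
    (h2 : orderOf w₂ = 3) (h12 : w₁ * w₂ = w₂ * w₁) (p : P18) :
    rectHom33 hc h1 h2 h12 p = c ^ (Multiplicative.toAdd p.1).val *
      (w₁ ^ (Multiplicative.toAdd p.2.1).val * w₂ ^ (Multiplicative.toAdd p.2.2).val) := rfl

/-- `rectHom33 (1,0,0) = c`. -/
theorem rectHom33_conj {c : G} (hc : IsComplexConj c) {w₁ w₂ : G} (h1 : orderOf w₁ = 3)
    (h2 : orderOf w₂ = 3) (h12 : w₁ * w₂ = w₂ * w₁) : rectHom33 hc h1 h2 h12 rectConj33 = c := by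
  rw [rectHom33_apply]
  show c ^ (1 : ZMod 2).val * (w₁ ^ (0 : ZMod 3).val * w₂ ^ (0 : ZMod 3).val) = c
  simp only [ZMod.val_zero, val_one_two, pow_zero, pow_one, mul_one]

/-- `rectHom33` is injective when `w₂ ∉ ⟨w₁⟩`: cubing `cˢ w₁ᵃ w₂ᵇ = 1` gives `cˢ = 1`, so `s = 0`; then
`w₁ᵃ w₂ᵇ = 1` puts `w₂ᵇ`, hence `w₂` (as `b ∈ {1, 2}` is invertible mod `3`), into `⟨w₁⟩` unless `b = 0`, and
then `a = 0` as `w₁` has order `3`. -/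
theorem rectHom33_injective {c : G} (hc : IsComplexConj c) {w₁ w₂ : G} (h1 : orderOf w₁ = 3)
    (h2 : orderOf w₂ = 3) (h12 : w₁ * w₂ = w₂ * w₁) (hw : w₂ ∉ Subgroup.zpowers w₁) :
    Function.Injective (rectHom33 hc h1 h2 h12) := by
  rw [injective_iff_map_eq_one]
  rintro ⟨s, a, b⟩ hp
  rw [rectHom33_apply] at hp
  dsimp only at hp
  have hs2 := ZMod.val_lt (Multiplicative.toAdd s)
  have ha3 := ZMod.val_lt (Multiplicative.toAdd a)
  have hb3 := ZMod.val_lt (Multiplicative.toAdd b)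
  set S := (Multiplicative.toAdd s).val with hS
  set A := (Multiplicative.toAdd a).val with hA
  set B := (Multiplicative.toAdd b).val with hB
  have hw1 : w₁ ^ 3 = 1 := by rw [← h1, pow_orderOf_eq_one]
  have hw2 : w₂ ^ 3 = 1 := by rw [← h2, pow_orderOf_eq_one]
  have hcomm1 : Commute (c ^ S) (w₁ ^ A * w₂ ^ B) :=
    Commute.mul_right (Commute.pow_pow (hc.comm w₁) _ _) (Commute.pow_pow (hc.comm w₂) _ _)
  have hcomm2 : Commute (w₁ ^ A) (w₂ ^ B) := Commute.pow_pow h12 _ _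
  -- cubing
  have hS0 : S = 0 := by
    have h : (c ^ S * (w₁ ^ A * w₂ ^ B)) ^ 3 = 1 := by rw [hp, one_pow]
    rw [hcomm1.mul_pow, hcomm2.mul_pow, ← pow_mul, ← pow_mul, ← pow_mul, mul_comm A 3, pow_mul w₁ 3 A,
      hw1, one_pow, mul_comm B 3, pow_mul w₂ 3 B, hw2, one_pow, one_mul, mul_one] at h
    -- `c ^ (S * 3) = 1`
    have hsv : S = 0 ∨ S = 1 := by omega
    rcases hsv with hs0 | hs1
    · exact hs0
    · rw [hs1, one_mul, show (3 : ℕ) = 2 + 1 by rfl, pow_succ, pow_two, hc.mul_self, one_mul] at h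
      exact absurd h hc.ne_one
  rw [hS0, pow_zero, one_mul] at hp
  -- `w₁ ^ A * w₂ ^ B = 1`
  have hB0 : B = 0 := by
    have hbv : B = 0 ∨ B = 1 ∨ B = 2 := by omega
    rcases hbv with hb0 | hb1 | hb2
    · exact hb0
    · exfalso
      rw [hb1, pow_one] at hp
      apply hw
      rw [Subgroup.mem_zpowers_iff]
      refine ⟨-(A : ℤ), ?_⟩
      rw [zpow_neg, zpow_natCast]
      exact inv_eq_of_mul_eq_one_right hp
    · exfalso
      rw [hb2] at hp
      apply hw
      rw [Subgroup.mem_zpowers_iff]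
      -- `w₂ = w₂ ^ 4 = (w₂ ^ 2) ^ 2 = ((w₁ ^ A)⁻¹) ^ 2 = w₁ ^ (-(A * 2))`
      refine ⟨-((A : ℤ) * 2), ?_⟩
      have hw2sq : w₂ ^ 2 = (w₁ ^ A)⁻¹ := (inv_eq_of_mul_eq_one_right hp).symm
      have hw24 : w₂ = (w₂ ^ 2) ^ 2 := by
        rw [← pow_mul, show (2 * 2 : ℕ) = 3 + 1 by rfl, pow_succ, hw2, one_mul]
      rw [zpow_neg, zpow_mul, zpow_natCast, zpow_ofNat, ← inv_pow, ← hw2sq, ← hw24]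
  rw [hB0, pow_zero, mul_one] at hp
  have hA0 : A = 0 := by
    have := orderOf_dvd_of_pow_eq_one hp
    rw [h1] at this
    omega
  have hs : s = 1 := by
    rw [← ofAdd_toAdd s, (ZMod.val_eq_zero _).1 hS0, ofAdd_zero]
  have ha : a = 1 := by
    rw [← ofAdd_toAdd a, (ZMod.val_eq_zero _).1 hA0, ofAdd_zero]
  have hb : b = 1 := by
    rw [← ofAdd_toAdd b, (ZMod.val_eq_zero _).1 hB0, ofAdd_zero]
  rw [hs, ha, hb]
  rfl

/-- The quadruple `Φ, Φ(w₁c), Φ(w₂c), Φ(w₁w₂)`. -/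
def rectQuad33 (Φ : Finset G) (w₁ w₂ c : G) : Fin 4 → Finset G :=
  ![Φ, rmul Φ (c * w₁), rmul Φ (c * w₂), rmul Φ (w₁ * w₂)]

/-- `rectQuad33 Φ w₁ w₂ c` is the quadruple of twists by the `rectHom33 (rectTwist33 i)`. -/
theorem rectQuad33_eq_twists (Φ : Finset G) {c : G} (hc : IsComplexConj c) {w₁ w₂ : G}
    (h1 : orderOf w₁ = 3) (h2 : orderOf w₂ = 3) (h12 : w₁ * w₂ = w₂ * w₁) :
    rectQuad33 Φ w₁ w₂ c = fun i => rmul Φ (rectHom33 hc h1 h2 h12 (rectTwist33 i)) := by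
  funext i
  rw [rectHom33_apply]
  fin_cases i
  · show Φ = rmul Φ (c ^ (0 : ZMod 2).val * (w₁ ^ (0 : ZMod 3).val * w₂ ^ (0 : ZMod 3).val))
    simp only [ZMod.val_zero, pow_zero, one_mul, rmul_one]
  · show rmul Φ (c * w₁) = rmul Φ (c ^ (1 : ZMod 2).val * (w₁ ^ (1 : ZMod 3).val * w₂ ^ (0 : ZMod 3).val))
    simp only [ZMod.val_zero, val_one_two, val_one_three, pow_zero, pow_one, mul_one]
  · show rmul Φ (c * w₂) = rmul Φ (c ^ (1 : ZMod 2).val * (w₁ ^ (0 : ZMod 3).val * w₂ ^ (1 : ZMod 3).val))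
    simp only [ZMod.val_zero, val_one_two, val_one_three, pow_zero, pow_one, one_mul]
  · show rmul Φ (w₁ * w₂) =
      rmul Φ (c ^ (0 : ZMod 2).val * (w₁ ^ (1 : ZMod 3).val * w₂ ^ (1 : ZMod 3).val))
    simp only [ZMod.val_zero, val_one_three, pow_zero, pow_one, one_mul]

/-- **The two-order-`3` rectangle mechanism exists from degree `36` on.**  For every finite `(G, c)` and all
commuting `w₁, w₂` of order `3` with `w₂ ∉ ⟨w₁⟩`: if `36 ≤ |G|`, some CM type `Φ` has `Φ, Φ(cw₁), Φ(cw₂),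
Φ(w₁w₂)` `SumTwo` without a conjugate pair. -/
theorem exists_rectQuad33_of_elems [Fintype G] [DecidableEq G] {c : G} (hc : IsComplexConj c) {w₁ w₂ : G}
    (h1 : orderOf w₁ = 3) (h2 : orderOf w₂ = 3) (h12 : w₁ * w₂ = w₂ * w₁) (hw : w₂ ∉ Subgroup.zpowers w₁)
    (hG : 36 ≤ Fintype.card G) :
    ∃ Φ : Finset G, IsCMType c Φ ∧ SumTwo (rectQuad33 Φ w₁ w₂ c) ∧
      ∀ i j : Fin 4, rectQuad33 Φ w₁ w₂ c j ≠ c • rectQuad33 Φ w₁ w₂ c i := by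
  obtain ⟨Φ, hΦ, hs, hnc⟩ := exists_rectQuad33 (rectHom33 hc h1 h2 h12)
    (rectHom33_injective hc h1 h2 h12 hw) hc (rectHom33_conj hc h1 h2 h12) hG
  refine ⟨Φ, hΦ, ?_, ?_⟩
  · rw [rectQuad33_eq_twists Φ hc h1 h2 h12]; exact hs
  · rw [rectQuad33_eq_twists Φ hc h1 h2 h12]; exact hnc

end HodgeRepro.CosetQuad
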